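import Summits.CriticalPhenomena.CardyFormulaZ2.Theorems.CardyIKTransportIKLinearTransportWallDominationCylSubsetAux

/-!
# `CardyIKTransport.IKLinearTransport` (stmt-CriticalPhenomena-5076), line `pinned-diagram-exchange`, lead c8 wave 3 —
# WALL DOMINATION, planar transfer, CYLINDER SIDE: `thinRingCylSubset_pos`

Support file (`--supports stmt-CriticalPhenomena-5076`, registered sub-goal `thinRingCylSubset_pos` = `ThinRingCylSubset` of
`…WallDominationPlanarDefs` with the hypothesis `1 ≤ M`, without which it fails: for `M = 0` the margin boxes are empty and a
ring path may wrap around the off-band rows).  On the slab of `s + s` face columns and circumference `L = 2M + 7s + 1`,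
`s, M ≥ 1`, the chained thin-ring event `thinRingChain s s A B` (`A = [M+2s, M+3s)`, `B = [M, M+s)`) is contained in "the band
part `CylPlane.bandQ L (2M+3s-1)` lies in `ThinRingQ s M`" union the exit event `ExitCyl s M L`: every link of the event (the
right link, the left link, the links of the two chains) is a black connection of a half-slab from a wall cell of a window row, so
by the link dichotomy of the helper file (`cylSubset_rightLink` / `cylSubset_leftLink`: band-confined realising walks are planar
`BlackPathIn`s of the band observables, a walk leaving the band crosses a margin box bottom-to-top by discrete intermediate
values) either some link puts `x` in `ExitCyl s M L`, or all of them are planar black paths inside the two planar regions and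
the band observables lie in `ThinRingObs 0 0 s M` (`chain_transfer` maps the chains link by link).
-/

noncomputable section

namespace Summit.CriticalPhenomena.CardyFormulaZ2.Theorems.IKLinearTransport.PinnedDiagramExchange.WallDomination

open scoped BigOperators Classical
open Finset
open Summit.CriticalPhenomena.CardyFormulaZ2.Cruxes.IKMixedBoxCrossing.DefectClosureExploration

namespace ThinRingCylSubsetStub

variable {L : ℕ}

/-- CHAIN TRANSFER: a chain of links through wall rows of a window `W ⊆ [M, M+3s)` is, read on the band, a chain of planar
black paths inside the left or the right planar region through the corresponding integer rows — unless some link puts the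
configuration in the exit event. -/
theorem chain_transfer [NeZero L] {s M : ℕ} (hs : 1 ≤ s) (hM : 1 ≤ M) (hL : L = 2 * M + 7 * s + 1) (x : CylCfg (s + s) L)
    (W : Set (ZMod L)) (rows : Set ℤ) (hW : ∀ r ∈ W, M ≤ r.val ∧ r.val < M + 3 * s) (hWr : ∀ r ∈ W, (r.val : ℤ) ∈ rows)
    {a b : ZMod L} (h : chainRel s s W x a b) :
    Relation.ReflTransGen (fun y y' => y ∈ rows ∧ y' ∈ rows ∧
      (BlackPathIn (CylPlane.obsQ (CylPlane.bandQ L (2 * M + 3 * s - 1) x)) (leftRegion 0 0 s M) (wallCell 0 s y)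
          (wallCell 0 s y') ∨
        BlackPathIn (CylPlane.obsQ (CylPlane.bandQ L (2 * M + 3 * s - 1) x)) (rightRegion 0 0 s M) (wallCell 0 s y)
          (wallCell 0 s y'))) (a.val : ℤ) (b.val : ℤ) ∨ x ∈ ExitCyl s M L := by
  unfold chainRel at h
  induction h with
  | refl => exact Or.inl Relation.ReflTransGen.refl
  | tail _ hbc ih =>
    obtain ⟨hbW, hcW, hl⟩ := hbc
    rcases ih with ih | ih
    · rcases hl with hl | hl
      · rcases cylSubset_leftLink s M L hs hM hL x _ _ (hW _ hbW).1 (hW _ hbW).2 hl with h1 | h1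
        · exact Or.inl (ih.tail ⟨hWr _ hbW, hWr _ hcW, Or.inl h1⟩)
        · exact Or.inr h1
      · rcases cylSubset_rightLink s M L hs hM hL x _ _ (hW _ hbW).1 (hW _ hbW).2 hl with h1 | h1
        · exact Or.inl (ih.tail ⟨hWr _ hbW, hWr _ hcW, Or.inr h1⟩)
        · exact Or.inr h1
    · exact Or.inr ih

end ThinRingCylSubsetStub

open ThinRingCylSubsetStub in
/-- **CYLINDER SIDE OF THE PLANAR TRANSFER OF THIN RINGS** (registered sub-goal `thinRingCylSubset_pos`; `ThinRingCylSubset` with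
`1 ≤ M`): on the slab of `s + s` face columns and circumference `L = 2M + 7s + 1`, `s, M ≥ 1`, the chained thin-ring event with
windows `A = [M+2s, M+3s)`, `B = [M, M+s)` is contained in "the band part lies in `ThinRingQ s M`" union the exit event. -/
theorem thinRingCylSubset_pos : ∀ (s M L : ℕ) [NeZero L], 1 ≤ s → 1 ≤ M → L = 2 * M + 7 * s + 1 →
    thinRingChain s s {r : ZMod L | M + 2 * s ≤ r.val ∧ r.val < M + 3 * s} {r : ZMod L | M ≤ r.val ∧ r.val < M + s} ⊆
      (CylPlane.bandQ L (2 * M + 3 * s - 1) : CylCfg (s + s) L → CylPlane.Q (s + s) (2 * M + 3 * s - 1)) ⁻¹' ThinRingQ s M ∪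
        ExitCyl s M L := by
  intro s M L _ hs hM hL x hx
  obtain ⟨u, hu, u', hu', v, hv, v', hv', h1, h2, h3, h4⟩ := hx
  simp only [Set.mem_setOf_eq] at hu hu' hv hv'
  rcases cylSubset_rightLink s M L hs hM hL x u v (by omega) hu.2 h1 with h1 | h1
  swap; · exact Or.inr h1
  rcases cylSubset_leftLink s M L hs hM hL x u' v' (by omega) hu'.2 h2 with h2 | h2
  swap; · exact Or.inr h2
  rcases chain_transfer hs hM hL x {r : ZMod L | M + 2 * s ≤ r.val ∧ r.val < M + 3 * s} (rowsA 0 s M)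
    (fun r hr => by simp only [Set.mem_setOf_eq] at hr; omega)
    (fun r hr => by simp only [Set.mem_setOf_eq, rowsA] at hr ⊢; omega) h3 with h3 | h3
  swap; · exact Or.inr h3
  rcases chain_transfer hs hM hL x {r : ZMod L | M ≤ r.val ∧ r.val < M + s} (rowsB 0 s M)
    (fun r hr => by simp only [Set.mem_setOf_eq] at hr; omega)
    (fun r hr => by simp only [Set.mem_setOf_eq, rowsB] at hr ⊢; omega) h4 with h4 | h4
  swap; · exact Or.inr h4
  refine Or.inl ⟨(u.val : ℤ), ?_, (u'.val : ℤ), ?_, (v.val : ℤ), ?_, (v'.val : ℤ), ?_, h1, h2, h3, h4⟩ <;>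
    simp only [rowsA, rowsB, Set.mem_setOf_eq] <;> omega

end Summit.CriticalPhenomena.CardyFormulaZ2.Theorems.IKLinearTransport.PinnedDiagramExchange.WallDomination

end
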